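import Summits.HodgeConjecture.HodgeConjecture.Theorems.HCCMUnconditionalOfFloorPart2
import Summits.HodgeConjecture.HodgeConjecture.Theorems.HCCMUnconditionalHDelOfTwoFacts
import Literature.AlgebraicGeometry.ModuliOfAbelianVarieties.SiegelCanonicalModel
import Literature.AlgebraicGeometry.ShimuraVarieties.SiegelBorelExtension
import HarnessLib

/-!
# HC_CM modulo the GENERIC FLOOR — edition FLOOR-G v1 (`hc_cm_of_generic_floor_v1`)

Director g6 RULING s83 (3) (2026-08-28): the GENERIC-KIND companion of the floor of record ★ `hc_cm_of_floor_v10`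
(`HCCMUnconditionalOfFloorPart2.lean`, FLOOR 6, print-exact).  ONE binder changes KIND: the Liu-specific row I-1′
`hF1e : UnitaryCanonicalModel.Aux.canonicalModel_exists_ext_printed` (Deligne-type canonical model of the EXTENDED unitary Shimura
datum, [Liu2021] §3 / App. D currency) is REPLACED by the two TEXTBOOK named facts that the T3 line `Cruxes/HDel/Lines/F1ExtHodgeType.lean`
(v4.4, skeleton 937542982016337c) leaves as its only FACT stubs once its five provable stubs are closed by name:
* row I-7 #60 `hS1 : SiegelS1` — [Deligne1971TravauxShimura, Thm. 4.21] canonical model of the Siegel modular variety with its integral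
  Hecke correspondences (named-fact file ★ p638856 `ModuliOfAbelianVarieties/SiegelCanonicalModel.lean`);
* row I-8 #61 `hBorel : siegel_borel_extension` — [Borel1972ExtensionTheorem, Thm. 3.10] / [Milne2005ShimuraVarieties, Thm. 3.14] holomorphic maps
  from the ball quotients into Siegel modular varieties are algebraic (named-fact file ★ p642679 `ShimuraVarieties/SiegelBorelExtension.lean`);
consumed through `HDel_of_two_facts (hS1) (hBorel) : …Theses.HCCMUnconditional.HDel` (`HCCMUnconditionalHDelOfTwoFacts.lean`, s83 (2):
`HDel_of_receptacle (QArch.ambientReceptacle_of' hS1 stub_frame stub_S2inj (stub_S2pair_holds hB stub_periodChart) (S2Imm_of_periodChart stub_periodChart)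
stub_Squot stub_S4)` over the closed stubs).  Everything else is v10 VERBATIM (binder texts `hdictE` / `hJ3a` / `hocc` / `hFal` / `h415` token-identical;
`h21 := Theorems.H21_proof`; `h413 := Hyp413Closing.H413_of_three_facts_flat hdictE hJ3a hocc`; `hLiu418 := HypLiu418.HLiu418_of_two_facts hFal h415 h21 h413`;
H411, HD3, HD1″ closed constants).

Hypotheses = EXACTLY SEVEN: I-7 `hS1`, I-8 `hBorel`, III-2 (a)′ `hdictE`, III-J3a `hJ3a`, III-2 (c)′ `hocc`, VI-1 `hFal`, III-9′ `h415` — the GENERIC FLOOR 7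
reported BESIDE the minimum FLOOR 6 (HOURLY BLOCK 19/20 decision (2): «kind versus count»; fan A 3/7 unchanged — item 24835 `HDel` stays OPEN until #60 and
#61 are themselves proved over Mathlib).

A STATUS theorem, not a discharge: HC_CM is proved only modulo the 7 printed citations until rung 0 closes.
-/

set_option autoImplicit false

-- mandated namespace `Summit.HodgeConjecture.HodgeConjecture.Theorems` trips `linter.dupNamespace` (single-problem summit); off as in
-- `HCCMUnconditionalOfFloor.lean` / `HCCMUnconditionalOfFloorPart2.lean`.
set_option linter.dupNamespace false

noncomputable section

namespace Summit.HodgeConjecture.HodgeConjecture.Theorems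

open scoped TensorProduct Matrix
open NumberField NumberField.InfinitePlace IsDedekindDomain
open HodgeCM.Model HodgeCM.Model.LiuIndex HodgeCM.Model.TowerCarrier
open Summit.HodgeConjecture.CorCM.Model
open Literature.AlgebraicGeometry.Motives (CMType AbelianVariety)
open Literature.AlgebraicGeometry.HodgeTheory Literature.NumberTheory.Automorphic.PicardCM
open Literature.AlgebraicGeometry.ShimuraVarieties Literature.AlgebraicGeometry.ShimuraVarieties.UnitaryCanonicalModel
open Literature.NumberTheory.ComplexMultiplication
open Literature.NumberTheory.Automorphic
open Literature.NumberTheory.Automorphic.Liu2021 Literature.NumberTheory.Automorphic.Liu2021.AppendixC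
open Literature.NumberTheory.Automorphic.Liu2021.Def411WeilCarriers (lineOf locF Rep)
open Summit.HodgeConjecture.CorCM.Transposition.OmegaTransport (realUnit)
open HodgeCM.Model.ArchSideTerm (e₁)
open Literature.NumberTheory.GelbartRogawski1991 Literature.NumberTheory.GelbartRogawski1991.UnitaryDualPair
open Literature.RepresentationTheory Literature.RepresentationTheory.Liu2021
open Summit.HodgeConjecture.CorCM
open Summit.HodgeConjecture.CorCM.Transposition
open Literature.NumberTheory.GelbartRogawski1991.OscillatorTripleDictionary (OccursInH1 IsIsoToOmega)
open Summit.HodgeConjecture.CorCM.Lines.A3Liu418 (Thm415AtFace EpsRigidAtFace)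
open Summit.HodgeConjecture.HodgeConjecture.Theses (HCCMUnconditional.HDel)

set_option synthInstance.maxHeartbeats 400000 in
set_option maxHeartbeats 8000000 in
/-- **GENERIC FLOOR EDITION v1** (director g6 RULING s83 (3)): `hc_cm_of_floor_v10` with the Liu-specific extended-canonical-model binder I-1′ `hF1e`
replaced by the two textbook facts I-7 `hS1 : SiegelS1` ([Deligne1971TravauxShimura] Thm. 4.21) and I-8 `hBorel : siegel_borel_extension`
([Borel1972ExtensionTheorem] Thm. 3.10), consumed via `HDel_of_two_facts hS1 hBorel`; the other five binders and the whole body are v10 verbatim.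
Hypotheses = EXACTLY: I-7 `hS1`, I-8 `hBorel`, III-2 (a)′ `hdictE`, III-J3a `hJ3a`, III-2 (c)′ `hocc`, VI-1 `hFal`, III-9′ `h415` (**7**, generic kind).
A STATUS theorem: HC_CM is proved only modulo the 7 printed citations until rung 0 closes.
[cite: Deligne1971TravauxShimura, Thm. 4.21 p. 152] [cite: Borel1972ExtensionTheorem, Thm. 3.10 p. 559] [cite: Milne2005ShimuraVarieties, Thm. 3.14; Prop. 14.12]
[cite: Liu2021, Thm. 4.18; Prop. 4.13 and its proof l. 2145; Rem. 4.14; Thm. 4.15; App. D Lem. D.1] [cite: GelbartRogawski1991, Thm. 5.1.1 (p. 448); p. 446]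
[cite: Li1992, Thm. 2.1] [cite: Rogawski1990, Thm. 13.3.1] [cite: Shimura1998, Thm. 21.4; Thm. 18.6] [cite: Faltings1983, Satz 4] -/
theorem hc_cm_of_generic_floor_v1
    -- `hDel` ⇐ rows I-7 #60 (Deligne 1971 Thm. 4.21) and I-8 #61 (Borel 1972 Thm. 3.10) via `HDel_of_two_facts` (T3 line, five stubs closed by name)
    (hS1 : Literature.AlgebraicGeometry.ModuliOfAbelianVarieties.SiegelS1)
    (hBorel : Literature.AlgebraicGeometry.ShimuraVarieties.siegel_borel_extension)
    -- `h21` := the closed constant `Theorems.H21_proof` ([Shimura1998] Thm. 21.4 in Serre–Tate currency ⇐ Thm. 18.6 ★ p631138); NO r₀, NO NOS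
    -- `h413` ⇐ rows III-2 (a)′ EXISTENCE, III-J3a, III-2 (c)′ «admissible ⇒ occurs in H¹» at the printed datum (E-III2 R1′, print-exact)
    (hdictE :
      ∀ (hDel : Literature.AlgebraicGeometry.ShimuraVarieties.UnitaryCanonicalModel.canonicalModel_exists_printed)
        (F : HodgeCM.CMField) [IsGalois ℚ F] (h6 : 6 ≤ Module.finrank ℚ F) {ι₁ : F →+* ℂ} (V : HodgeCM.HermSpace3 F ι₁) (a₀ : RealScalar F)
        (Φ : CMType F) (hΦ : ι₁ ∈ Φ.1) (i : (I V (repAt a₀) (muLiu ι₁ GramClass.rep))),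
        oscillatorTriple_dictionaryExistence (((uniformOmegaRep (Summit.HodgeConjecture.CorCM.DelRec.exists_recordSystem_of_printed hDel) ⟨HodgeCM.CMField.K F⟩ ι₁ ⟨HodgeCM.HermSpace3.Hm V, HodgeCM.HermSpace3.isHermitian V, HodgeCM.HermSpace3.signature_ι₁ V, HodgeCM.HermSpace3.posDef_of_ne V⟩ Φ e₁ (frameD V) (frameD_real V) (frameD_ne V) (ιVE V) (2 * imagUnit (HodgeCM.CMField.K F))⁻¹ (fun _ _ => (Rep.update ↥(maximalRealSubfield (HodgeCM.CMField.K F)) (imagUnitSq (HodgeCM.CMField.K F)) (Rep.ofLineOf ↥(maximalRealSubfield (HodgeCM.CMField.K F)) (imagUnitSq (HodgeCM.CMField.K F))) (locF ↥(maximalRealSubfield (HodgeCM.CMField.K F)) (imagUnitSq (HodgeCM.CMField.K F)) (realUnit ⟨HodgeCM.CMField.K F⟩ (repAt a₀ (Sigma.fst i)).1 (repAt a₀ (Sigma.fst i)).2.1 (repAt a₀ (Sigma.fst i)).2.2)) (realUnit ⟨HodgeCM.CMField.K F⟩ (repAt a₀ (Sigma.fst i)).1 (repAt a₀ (Sigma.fst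 i)).2.1 (repAt a₀ (Sigma.fst i)).2.2) rfl)))).prop413Data ((liuDictionaryPin exists_isReal_hodgeModel_holds hodgePQ_independent_of_hodgeModel_holds BallQuotient.ballQuotientUniformised_holds (cmAbelianVarietyRealised_of_eigenbasis exists_isReal_hodgeModel_holds hodgePQ_independent_of_hodgeModel_holds cmAbelianVarietyEigenbasisRealised_holds) Literature.NumberTheory.Transcendental.arapura2012_cor_15_4_6_holds V (I V (repAt a₀) (muLiu ι₁ GramClass.rep)) (line V (repAt a₀) (muLiu ι₁ GramClass.rep)))).H))
    (hJ3a :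
      ∀ (hDel : Literature.AlgebraicGeometry.ShimuraVarieties.UnitaryCanonicalModel.canonicalModel_exists_printed)
        (F : HodgeCM.CMField) [IsGalois ℚ F] (h6 : 6 ≤ Module.finrank ℚ F) {ι₁ : F →+* ℂ} (V : HodgeCM.HermSpace3 F ι₁) (a₀ : RealScalar F)
        (Φ : CMType F) (hΦ : ι₁ ∈ Φ.1) (i : (I V (repAt a₀) (muLiu ι₁ GramClass.rep))),
        (((uniformOmegaRep (Summit.HodgeConjecture.CorCM.DelRec.exists_recordSystem_of_printed hDel) ⟨HodgeCM.CMField.K F⟩ ι₁ ⟨HodgeCM.HermSpace3.Hm V, HodgeCM.HermSpace3.isHermitian V, HodgeCM.HermSpace3.signature_ι₁ V, HodgeCM.HermSpace3.posDef_of_ne V⟩ Φ e₁ (frameD V) (frameD_real V) (frameD_ne V) (ιVE V) (2 * imagUnit (HodgeCM.CMField.K F))⁻¹ (fun _ _ => (Rep.update ↥(maximalRealSubfield (HodgeCM.CMField.K F)) (imagUnitSq (HodgeCM.CMField.K F)) (Rep.ofLineOf ↥(maximalRealSubfield (HodgeCM.CMField.K F)) (imagUnitSq (HodgeCM.CMField.K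 F))) (locF ↥(maximalRealSubfield (HodgeCM.CMField.K F)) (imagUnitSq (HodgeCM.CMField.K F)) (realUnit ⟨HodgeCM.CMField.K F⟩ (repAt a₀ (Sigma.fst i)).1 (repAt a₀ (Sigma.fst i)).2.1 (repAt a₀ (Sigma.fst i)).2.2)) (realUnit ⟨HodgeCM.CMField.K F⟩ (repAt a₀ (Sigma.fst i)).1 (repAt a₀ (Sigma.fst i)).2.1 (repAt a₀ (Sigma.fst i)).2.2) rfl)))).prop413Data ((liuDictionaryPin exists_isReal_hodgeModel_holds hodgePQ_independent_of_hodgeModel_holds BallQuotient.ballQuotientUniformised_holds (cmAbelianVarietyRealised_of_eigenbasis exists_isReal_hodgeModel_holds hodgePQ_independent_of_hodgeModel_holds cmAbelianVarietyEigenbasisRealised_holds) Literature.NumberTheory.Transcendental.arapura2012_cor_15_4_6_holds V (I V (repAt a₀) (muLiu ι₁ GramClass.rep)) (line V (repAt a₀) (muLiu ι₁ GramClass.rep)))).H).multiplicity_le_one_printed)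
    (hocc :
      ∀ (hDel : Literature.AlgebraicGeometry.ShimuraVarieties.UnitaryCanonicalModel.canonicalModel_exists_printed)
        (F : HodgeCM.CMField) [IsGalois ℚ F] (h6 : 6 ≤ Module.finrank ℚ F) {ι₁ : F →+* ℂ} (V : HodgeCM.HermSpace3 F ι₁) (a₀ : RealScalar F)
        (Φ : CMType F) (hΦ : ι₁ ∈ Φ.1) (i : (I V (repAt a₀) (muLiu ι₁ GramClass.rep))),
        admissible_occursInH1 (((uniformOmegaRep (Summit.HodgeConjecture.CorCM.DelRec.exists_recordSystem_of_printed hDel) ⟨HodgeCM.CMField.K F⟩ ι₁ ⟨HodgeCM.HermSpace3.Hm V, HodgeCM.HermSpace3.isHermitian V, HodgeCM.HermSpace3.signature_ι₁ V, HodgeCM.HermSpace3.posDef_of_ne V⟩ Φ e₁ (frameD V) (frameD_real V) (frameD_ne V) (ιVE V) (2 * imagUnit (HodgeCM.CMField.K F))⁻¹ (fun _ _ => (Rep.update ↥(maximalRealSubfield (HodgeCM.CMField.K F)) (imagUnitSq (HodgeCM.CMField.K F)) (Rep.ofLineOf ↥(maximalRealSubfield (HodgeCM.CMField.K F)) (imagUnitSq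 (HodgeCM.CMField.K F))) (locF ↥(maximalRealSubfield (HodgeCM.CMField.K F)) (imagUnitSq (HodgeCM.CMField.K F)) (realUnit ⟨HodgeCM.CMField.K F⟩ (repAt a₀ (Sigma.fst i)).1 (repAt a₀ (Sigma.fst i)).2.1 (repAt a₀ (Sigma.fst i)).2.2)) (realUnit ⟨HodgeCM.CMField.K F⟩ (repAt a₀ (Sigma.fst i)).1 (repAt a₀ (Sigma.fst i)).2.1 (repAt a₀ (Sigma.fst i)).2.2) rfl)))).prop413Data ((liuDictionaryPin exists_isReal_hodgeModel_holds hodgePQ_independent_of_hodgeModel_holds BallQuotient.ballQuotientUniformised_holds (cmAbelianVarietyRealised_of_eigenbasis exists_isReal_hodgeModel_holds hodgePQ_independent_of_hodgeModel_holds cmAbelianVarietyEigenbasisRealised_holds) Literature.NumberTheory.Transcendental.arapura2012_cor_15_4_6_holds V (I V (repAt a₀) (muLiu ι₁ GramClass.rep)) (line V (repAt a₀) (muLiu ι₁ GramClass.rep)))).H))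
    -- `hLiu418` ⇐ rows VI-1, III-9′ (III-0 Liu Lem. 2.4 (1) and III-11 by their CLOSED tree terms)
    (hFal : ∀ {K : Type} [Field K] (A B : AbelianVariety K) (ℓ : ℕ) [Fact ℓ.Prime], Literature.AlgebraicGeometry.Motives.faltings_tate_bijective A B ℓ)
    (h415 : Thm415AtFace) :
    Summit.HodgeConjecture.HodgeConjecture.Theses.RankFourFaces.CMAbelianHodge :=
  have h21 : Summit.HodgeConjecture.HodgeConjecture.Theses.HCCMUnconditional.H21 := H21_proof
  have hD3 := Summit.HodgeConjecture.CorCM.HypD3.hD3_of_twistRigidity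
    Literature.RepresentationTheory.MoeglinVignerasWaldspurger1987.rankOne_theta_twist_rigidity_holds
  have h413 := Summit.HodgeConjecture.CorCM.Hyp413Closing.H413_of_three_facts_flat hdictE hJ3a hocc
  Summit.HodgeConjecture.HodgeConjecture.Theses.HCCMUnconditional.closes (HDel_of_two_facts hS1 hBorel) h21
    (Summit.HodgeConjecture.CorCM.HypLiu418.HLiu418_of_two_facts hFal h415 h21 h413) h413 H411_proof hD3 HD1pp_proof

end Summit.HodgeConjecture.HodgeConjecture.Theorems

end
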